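import Literature.Analysis.Complex.PickFunctions
import Literature.Analysis.Convolution.ScaledMollifier

/-!
# Loewner's theorem, Part I: definitions

Vocabulary for the sorry-free discharge of the named fact
`Literature.Analysis.Complex.loewner_theorem` (Löwner 1934; Rosenblum–Rovnyak, *Hardy Classes and
Operator Theory* (1985), Ch. 2, Examples and Addenda no. 1), direction (→): a matrix monotone
function of every order on an open interval `Δ` is the restriction of a Pick function holomorphic
across `Δ`. The proof formalized in the files `LoewnerMatrixCalculus`, `LoewnerCriteria`,
`LoewnerHansenPedersen`, `LoewnerExtremePoints`, `LoewnerTheoremProofs` is the Hansen–Pedersen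
extreme-point proof as presented in F. Hiai, D. Petz, *Introduction to Matrix Analysis and
Applications* (2014), §4.4 (Lemmas 4.34–4.37, Theorems 4.38–4.39), reorganized so that NO a
priori regularity theory of matrix monotone functions is needed (Hiai–Petz use `2`-monotone ⇒ `C¹`
and Kraus' theorem tacitly): smooth matrix monotone functions are produced by mollification, the
compact convex set is the closure `K̄` of the smooth normalized class, and Löwner's/Kraus'
differential criteria are proved only in the direction and generality actually needed.

This file only holds the DEFINITIONS (all with bodies, no named facts), so that the theorem files
are pure-proof files:

* divided differences of monomials/polynomials/functions (`pdd1`, `pdd2`, `polyDD1`, `polyDD2`,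
  `dd1`, `dd2`), the noncommutative expansion coefficients `expandCoeff`, `polyCoeff`, a
  polynomial antiderivative `antideriv`, the entrywise size `entrySum`, the real quadratic form
  `qform`/`qformL`;
* matrix convexity `IsMatrixConvexOn` (Kraus 1936; Hiai–Petz §4.2);
* the Hansen–Pedersen objects: `qOp` (`(1 + α/x) f`), the smooth normalized class `classK`, its
  closure `Kbar`, the box `boxLo`/`boxHi`/`boxSet`, the regularization operators `clampF`, `regF`,
  `regA`, `normF`, the atoms `atomJ`, the operation `hOp`, finite convex combinations of atoms
  `AtomData`;
* the approximation scheme of the final assembly: `epsSeq`, `fmoll`, `fresc`, `aSeq`, `fnorm`,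
  `testPts`, `tolSeq`, `atomSeq`, `gSeq`, and the gluing data `Gof`, `Adm`, `Gglue`.

Junk values: `dd2 f x x z = 0`, `qOp α g 0 = α` (the value forced by `g(0)=0`, `g'(0)=1`),
functions of the classes are extended by `0` off `(-1,1)`, `atomSeq`/`Gof`/`Gglue` return a
trivial value when the defining existential fails (it never does under the hypotheses of the
theorems using them).

## References
* K. Löwner, Über monotone Matrixfunktionen, *Math. Z.* 38 (1934) 177–216.
* F. Hansen, G. K. Pedersen, Jensen's inequality for operators and Löwner's theorem,
  *Math. Ann.* 258 (1982) 229–241.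
* F. Hiai, D. Petz, *Introduction to Matrix Analysis and Applications*, Universitext, Springer /
  Hindustan Book Agency (2014), §4.4. [`HiaiPetz2014`]
* M. Rosenblum, J. Rovnyak, *Hardy Classes and Operator Theory*, OUP (1985), Ch. 2 Addenda no. 1.
  [`RosenblumRovnyak1985`]
-/

noncomputable section

open Finset Matrix Polynomial
open scoped ComplexOrder

namespace Literature.Analysis.Complex

/-! ### Divided differences -/

/-- First divided difference of `t ↦ t^m`: `pdd1 m x y = ∑_{j<m} x^j y^{m-1-j}`, defined by the
recursion `pdd1 (m+1) x y = pdd1 m x y * y + x^m`. [folklore] -/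
def pdd1 : ℕ → ℝ → ℝ → ℝ
  | 0, _, _ => 0
  | m + 1, x, y => pdd1 m x y * y + x ^ m

/-- Second divided difference of `t ↦ t^m`, by the recursion
`pdd2 (m+1) x y z = pdd2 m x y z * z + pdd1 m x y`. [folklore] -/
def pdd2 : ℕ → ℝ → ℝ → ℝ → ℝ
  | 0, _, _, _ => 0
  | m + 1, x, y, z => pdd2 m x y z * z + pdd1 m x y

/-- The (algebraic) first divided difference of a real polynomial. [folklore] -/
def polyDD1 (p : ℝ[X]) (x y : ℝ) : ℝ := p.sum fun m c => c * pdd1 m x y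

/-- The (algebraic) second divided difference of a real polynomial. [folklore] -/
def polyDD2 (p : ℝ[X]) (x y z : ℝ) : ℝ := p.sum fun m c => c * pdd2 m x y z

/-- First divided difference `f[x, y]` of a function `f`, with the derivative on the diagonal.
[folklore] -/
def dd1 (f : ℝ → ℝ) (x y : ℝ) : ℝ := if x = y then deriv f x else (f x - f y) / (x - y)

/-- Second divided difference of `f` with base point `z` (slope of `t ↦ f[t, z]`; the value on
the diagonal `x = y` is irrelevant for our identities and set to `0`). [folklore] -/
def dd2 (f : ℝ → ℝ) (x y z : ℝ) : ℝ := if x = y then 0 else (dd1 f x z - dd1 f y z) / (x - y)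

/-- A polynomial antiderivative: `antideriv p = ∑ₖ (aₖ/(k+1)) X^{k+1}`. [folklore] -/
def antideriv (p : ℝ[X]) : ℝ[X] :=
  ∑ k ∈ range (p.natDegree + 1), C (p.coeff k / (k + 1)) * X ^ (k + 1)

/-! ### Matrix expansions, entrywise size, quadratic forms -/

section MatrixDefs

variable {ι : Type*} [Fintype ι]

/-- The entrywise `ℓ¹` size `∑_{a,b} ‖M a b‖` of a complex matrix. [folklore] -/
def entrySum (M : Matrix ι ι ℂ) : ℝ := ∑ a, ∑ b, ‖M a b‖

/-- The real quadratic form `re ⟨w, M w⟩`. [folklore] -/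
def qform (M : Matrix ι ι ℂ) (w : ι → ℂ) : ℝ := (star w ⬝ᵥ (M *ᵥ w)).re

/-- Additivity of the quadratic form in the matrix. [folklore] -/
theorem qform_add (M N : Matrix ι ι ℂ) (w : ι → ℂ) : qform (M + N) w = qform M w + qform N w := by
  simp [qform, Matrix.add_mulVec, dotProduct_add]

/-- The quadratic form of a difference. [folklore] -/
theorem qform_sub (M N : Matrix ι ι ℂ) (w : ι → ℂ) : qform (M - N) w = qform M w - qform N w := by
  simp [qform, Matrix.sub_mulVec, dotProduct_sub]

/-- Homogeneity of the quadratic form for real scalars written through `ℂ`. [folklore] -/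
theorem qform_smul (c : ℝ) (M : Matrix ι ι ℂ) (w : ι → ℂ) :
    qform ((c : ℂ) • M) w = c * qform M w := by
  simp [qform, Matrix.smul_mulVec, dotProduct_smul]

/-- Homogeneity of the quadratic form for real scalars. [folklore] -/
theorem qform_real_smul (c : ℝ) (M : Matrix ι ι ℂ) (w : ι → ℂ) :
    qform (c • M) w = c * qform M w := by
  rw [← qform_smul, ← algebraMap_smul ℂ c M]; rfl

/-- The real quadratic form as a continuous `ℝ`-linear functional on matrices. [folklore] -/
def qformL (w : ι → ℂ) : Matrix ι ι ℂ →L[ℝ] ℝ :=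
  LinearMap.toContinuousLinearMap
    { toFun := fun M => qform M w
      map_add' := fun M N => qform_add M N w
      map_smul' := fun c M => by
        change qform (c • M) w = c * qform M w
        exact qform_real_smul c M w }

variable [DecidableEq ι]

/-- Coefficient matrices of the expansion `(D + s H)^m = ∑_r s^r • expandCoeff D H m r`
(`expandCoeff D H m r` = sum of the words in `D, H` of length `m` with exactly `r` letters `H`).
[folklore] -/
def expandCoeff (D H : Matrix ι ι ℂ) : ℕ → ℕ → Matrix ι ι ℂ
  | 0, 0 => 1
  | 0, _ + 1 => 0
  | m + 1, 0 => expandCoeff D H m 0 * D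
  | m + 1, r + 1 => expandCoeff D H m (r + 1) * D + expandCoeff D H m r * H

/-- Coefficient matrices of `p(D + sH) = ∑_r s^r • polyCoeff D H p r`. [folklore] -/
def polyCoeff (D H : Matrix ι ι ℂ) (p : ℝ[X]) (r : ℕ) : Matrix ι ι ℂ :=
  ∑ m ∈ range (p.natDegree + 1), (p.coeff m : ℂ) • expandCoeff D H m r

end MatrixDefs

/-! ### Matrix convexity -/

/-- **`f` is a matrix convex function on `Δ`** (all orders): for Hermitian `A, B ∈ Mₙ(ℂ)` with
spectra in `Δ` and `0 ≤ c ≤ 1` (with the spectrum of `cA + (1-c)B` in `Δ`, automatic for an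
interval), `f(cA + (1-c)B) ≤ c f(A) + (1-c) f(B)` in the Löwner order (Kraus 1936).
[cite: HiaiPetz2014, §4.2, Definition before Theorem 4.22] -/
def IsMatrixConvexOn (f : ℝ → ℝ) (Δ : Set ℝ) : Prop :=
  ∀ (n : ℕ) (A B : Matrix (Fin n) (Fin n) ℂ), A.IsHermitian → B.IsHermitian →
    spectrum ℝ A ⊆ Δ → spectrum ℝ B ⊆ Δ → ∀ c : ℝ, 0 ≤ c → c ≤ 1 →
      spectrum ℝ ((c : ℂ) • A + ((1 - c : ℝ) : ℂ) • B) ⊆ Δ →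
        ((c : ℂ) • cfc f A + ((1 - c : ℝ) : ℂ) • cfc f B -
          cfc f ((c : ℂ) • A + ((1 - c : ℝ) : ℂ) • B)).PosSemidef

/-! ### The Hansen–Pedersen objects on `(-1,1)` -/

/-- Hiai–Petz's operation `f ↦ (1 + α/x) f(x)` on functions normalized by `f(0) = 0`,
`f'(0) = 1`: `qOp α g x = g x + α g x / x` for `x ≠ 0` and `qOp α g 0 = α`.
[cite: HiaiPetz2014, Lemma 4.34 (2)] -/
def qOp (α : ℝ) (g : ℝ → ℝ) : ℝ → ℝ := fun x => if x = 0 then α else g x + α * (g x / x)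

/-- The smooth normalized Hansen–Pedersen class `𝒞`: matrix monotone functions on `(-1,1)` with
`C²` data there, `f(0) = 0`, `f'(0) = 1`, extended by `0` off `(-1,1)` (the smooth part of
Hiai–Petz's `𝒦`). [cite: HiaiPetz2014, §4.4, the class 𝒦] -/
def classK : Set (ℝ → ℝ) :=
  {f | IsMatrixMonotoneOn f (Set.Ioo (-1) 1) ∧
    (∃ f' f'' : ℝ → ℝ, (∀ x ∈ Set.Ioo (-1 : ℝ) 1, HasDerivAt f (f' x) x) ∧
      (∀ x ∈ Set.Ioo (-1 : ℝ) 1, HasDerivAt f' (f'' x) x) ∧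
      ContinuousOn f'' (Set.Ioo (-1) 1) ∧ f' 0 = 1) ∧
    f 0 = 0 ∧ ∀ x ∉ Set.Ioo (-1 : ℝ) 1, f x = 0}

/-- The compact convex set `K̄ = closure 𝒞` for pointwise convergence (product topology of
`ℝ → ℝ`). [cite: HiaiPetz2014, Lemma 4.36] -/
def Kbar : Set (ℝ → ℝ) := closure classK

/-- Lower envelope of the box containing `𝒞`: `x/(1+x)` on `(-1,1)`, `0` outside.
[cite: HiaiPetz2014, Lemma 4.35] -/
def boxLo (x : ℝ) : ℝ := if x ∈ Set.Ioo (-1 : ℝ) 1 then x / (1 + x) else 0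

/-- Upper envelope of the box containing `𝒞`: `x/(1-x)` on `(-1,1)`, `0` outside.
[cite: HiaiPetz2014, Lemma 4.35] -/
def boxHi (x : ℝ) : ℝ := if x ∈ Set.Ioo (-1 : ℝ) 1 then x / (1 - x) else 0

/-- The compact box `∏ₓ [boxLo x, boxHi x]` containing `𝒞`. [folklore] -/
def boxSet : Set (ℝ → ℝ) := Set.pi Set.univ fun x => Set.Icc (boxLo x) (boxHi x)

/-- Clamp of `F` to `[-1+δ, 1-δ]` (constant extension outside; monotone if `F` is monotone on
`(-1,1)`). [folklore] -/
def clampF (F : ℝ → ℝ) (δ : ℝ) : ℝ → ℝ := fun x => F (max (-1 + δ) (min x (1 - δ)))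

/-- The regularization `R_δ F (x) = (J_{δ/2} clampF F δ)((1 - 3δ) x)`: mollify (Mathlib's
normalized bump, radius `δ`), then rescale back to `(-1,1)`. [folklore] -/
def regF (F : ℝ → ℝ) (δ : ℝ) : ℝ → ℝ :=
  fun x => Convolution.mollify (δ / 2) (clampF F δ) ((1 - 3 * δ) * x)

/-- The derivative at `0` of the regularization `R_δ F`. [folklore] -/
def regA (F : ℝ → ℝ) (δ : ℝ) : ℝ := deriv (regF F δ) 0

/-- The normalized regularization `(R_δ F - R_δ F(0)) / (R_δ F)'(0)`, cut off outside `(-1,1)`.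
[folklore] -/
def normF (F : ℝ → ℝ) (δ : ℝ) : ℝ → ℝ :=
  fun x => if x ∈ Set.Ioo (-1 : ℝ) 1 then (regF F δ x - regF F δ 0) / regA F δ else 0

/-- The atom `x ↦ x/(1 - t x)` on `(-1,1)`, extended by `0` (the extreme points of `K̄`).
[cite: HiaiPetz2014, Lemma 4.37] -/
def atomJ (t : ℝ) : ℝ → ℝ := fun x => if x ∈ Set.Ioo (-1 : ℝ) 1 then x / (1 - t * x) else 0

/-- Hiai–Petz's `h_α = g_α/(1 + α f''(0)/2)` with `g_α = (1 + α/x) f - α`, cut off outside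
`(-1,1)` (`f''(0)/2` written as the derivative at `0` of `x ↦ f[x,0]`).
[cite: HiaiPetz2014, Lemma 4.37, proof] -/
def hOp (α : ℝ) (f : ℝ → ℝ) : ℝ → ℝ := fun x =>
  if x ∈ Set.Ioo (-1 : ℝ) 1 then (qOp α f x - α) / (1 + α * deriv (fun x => dd1 f x 0) 0) else 0

/-- Data of a finite convex combination of atoms `x/(1 - τᵢ x)`, `|τᵢ| ≤ 1` (an element of the
convex hull of the extreme points of `K̄`). [folklore] -/
structure AtomData where
  /-- index type -/
  ι : Type
  /-- support of the combination -/
  t : Finset ι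
  /-- weights -/
  w : ι → ℝ
  /-- pole parameters `τᵢ ∈ [-1,1]` -/
  τ : ι → ℝ
  /-- the weights are nonnegative -/
  hw : ∀ i ∈ t, 0 ≤ w i
  /-- the weights sum to `1` -/
  hsum : ∑ i ∈ t, w i = 1
  /-- the parameters lie in `[-1,1]` -/
  hτ : ∀ i ∈ t, τ i ∈ Set.Icc (-1 : ℝ) 1

/-- Real evaluation of a convex combination of atoms (no cut-off). [folklore] -/
def AtomData.evalR (d : AtomData) (x : ℝ) : ℝ := ∑ i ∈ d.t, d.w i * (x / (1 - d.τ i * x))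

/-- Complex evaluation of a convex combination of atoms (a rational Pick function).
[folklore] -/
def AtomData.evalC (d : AtomData) (z : ℂ) : ℂ :=
  ∑ i ∈ d.t, (d.w i : ℂ) * (z / (1 - d.τ i * z))

/-- The trivial atom data (the single atom `x`). [folklore] -/
def AtomData.trivial : AtomData where
  ι := Unit
  t := {()}
  w := fun _ => 1
  τ := fun _ => 0
  hw := fun _ _ => zero_le_one
  hsum := by simp
  hτ := fun _ _ => ⟨by norm_num, by norm_num⟩

/-! ### The approximation scheme of the assembly on `(-1,1)` -/

/-- Mollifier radii `ε_m = δ / (2(m+2))`. [folklore] -/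
def epsSeq (δ : ℝ) (m : ℕ) : ℝ := δ / (2 * (m + 2))

/-- The mollified clamped function `f_m = J_{ε_m} (clampF f δ)`. [folklore] -/
def fmoll (f : ℝ → ℝ) (δ : ℝ) (m : ℕ) : ℝ → ℝ :=
  Convolution.mollify (epsSeq δ m) (clampF f δ)

/-- Its rescaling to `(-1,1)`: `f̂_m (y) = f_m ((1 - 3δ) y)`. [folklore] -/
def fresc (f : ℝ → ℝ) (δ : ℝ) (m : ℕ) : ℝ → ℝ := fun y => fmoll f δ m ((1 - 3 * δ) * y)

/-- `a_m = f̂_m'(0)`. [folklore] -/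
def aSeq (f : ℝ → ℝ) (δ : ℝ) (m : ℕ) : ℝ := deriv (fresc f δ m) 0

/-- The normalized rescaled mollification `(f̂_m - f̂_m(0))/a_m` (no cut-off). [folklore] -/
def fnorm (f : ℝ → ℝ) (δ : ℝ) (m : ℕ) : ℝ → ℝ :=
  fun y => (fresc f δ m y - fresc f δ m 0) / aSeq f δ m

/-- Test points at stage `m`: the first `m+1` points of the enumeration `xs`, rescaled to
`(-1,1)`. [folklore] -/
def testPts (δ : ℝ) (xs : ℕ → ℝ) (m : ℕ) : Finset ℝ :=
  (Finset.range (m + 1)).image fun j => xs j / (1 - 3 * δ)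

/-- Tolerance at stage `m`: `1/((a_m + 1)(m+2))`. [folklore] -/
def tolSeq (f : ℝ → ℝ) (δ : ℝ) (m : ℕ) : ℝ := 1 / ((aSeq f δ m + 1) * (m + 2))

open scoped Classical in
/-- The atom data chosen at stage `m`: `tolSeq`-close to `fnorm f δ m` on the test points if
such data exist (Krein–Milman), the trivial data otherwise. [folklore] -/
def atomSeq (f : ℝ → ℝ) (δ : ℝ) (xs : ℕ → ℝ) (m : ℕ) : AtomData :=
  if h : ∃ d : AtomData, ∀ p ∈ testPts δ xs m, p ∈ Set.Ioo (-1 : ℝ) 1 →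
      |d.evalR p - fnorm f δ m p| < tolSeq f δ m
  then Classical.choose h else AtomData.trivial

/-- The rational Pick approximants `g_m(z) = f̂_m(0) + a_m ∑ wᵢ ζ/(1 - τᵢ ζ)`, `ζ = z/(1-3δ)`.
[folklore] -/
def gSeq (f : ℝ → ℝ) (δ : ℝ) (xs : ℕ → ℝ) (m : ℕ) : ℂ → ℂ := fun z =>
  (fresc f δ m 0 : ℂ) + (aSeq f δ m : ℂ) * (atomSeq f δ xs m).evalC (z / ((1 - 3 * δ : ℝ) : ℂ))

/-! ### Gluing data for general intervals -/

open scoped Classical in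
/-- A chosen Pick continuation of `f` across `(c - ρ, c + ρ)` (holomorphic on the slit domain
`{Im z ≠ 0 ∨ Re z ∈ (c-ρ, c+ρ)}`, `Im ≥ 0` on `Π`, `= f` on the interval) if one exists, else `0`.
[folklore] -/
def Gof (f : ℝ → ℝ) (c ρ : ℝ) : ℂ → ℂ :=
  if h : ∃ G : ℂ → ℂ, DifferentiableOn ℂ G {z : ℂ | z.im ≠ 0 ∨ z.re ∈ Set.Ioo (c - ρ) (c + ρ)} ∧
      (∀ z : ℂ, 0 < z.im → 0 ≤ (G z).im) ∧ ∀ x ∈ Set.Ioo (c - ρ) (c + ρ), G x = f x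
  then Classical.choose h else 0

/-- Admissible local data `(c, ρ)` at `z` relative to `Δ`: `ρ > 0`, `(c - 2ρ, c + 2ρ) ⊆ Δ`, and
`z` lies in the slit domain of `(c - ρ, c + ρ)`. [folklore] -/
def Adm (Δ : Set ℝ) (q : ℝ × ℝ) (z : ℂ) : Prop :=
  0 < q.2 ∧ Set.Ioo (q.1 - 2 * q.2) (q.1 + 2 * q.2) ⊆ Δ ∧
    (z.im ≠ 0 ∨ z.re ∈ Set.Ioo (q.1 - q.2) (q.1 + q.2))

open scoped Classical in
/-- The glued Pick continuation on the whole slit domain of `Δ`: at `z`, the local continuation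
of any admissible datum (well defined by the identity theorem), `0` if there is none. [folklore] -/
def Gglue (f : ℝ → ℝ) (Δ : Set ℝ) : ℂ → ℂ := fun z =>
  if h : ∃ q : ℝ × ℝ, Adm Δ q z then Gof f (Classical.choose h).1 (Classical.choose h).2 z else 0

end Literature.Analysis.Complex
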